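import Literature.AlgebraicGeometry.AbelianSchemes.AbelianSchemeEquivariantFibreTransport   -- ★ `IsBaseChangeVia.exists_fibreIso`, `fibreHom_comp_eq_of_left_comp_eq`
import Literature.AlgebraicGeometry.AbelianSchemes.AbelianSchemeOverZariskiGluingHom         -- ★ `isMonHom_of_isBaseChangeVia_id`
import Literature.AlgebraicGeometry.AbelianSchemes.AbelianSchemeOverRingAction               -- ★ `RingAction`
import Literature.AlgebraicGeometry.AbelianSchemes.RigidifiedLineBundleComapHom           -- ★ `AbelianSchemeOver.baseChangeHom` (ED. 2, §6)
import Literature.AlgebraicGeometry.Motives.AbelianVarietyAnalyticCharacterInvariance       -- ★ `charpoly_cotangentMap_eq_of_comp_eq_nsmul`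
import HarnessLib

/-!
# The Kottwitz characteristic polynomial `char(ι(b) | T_e^* A_s)` is an invariant of isomorphisms of tuples and of pull-back relations

Topic `AlgebraicGeometry/AbelianSchemes`; namespaces `Literature.AlgebraicGeometry.Motives.AbelianVariety` (§1) and
`Literature.AlgebraicGeometry.AbelianSchemes.AbelianSchemeOver` (§§2–5).  THEOREMS ONLY (no definition, no instance, no notation, no named
fact, no `sorry`).  Cell `hodgecm-mathlib` (D-0151), programme P6 «MOD» (crux hLiu418 = stmt-HodgeConjecture-24832, `--supports`, count-neutral),
LEAD F0P6-plan (g3) «M-47» ∕ addendum (2026-09-02): the P-line socket `stub_KOTT` («Kottwitz at the `Ω`-points of the spread tuple») is fed by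
★ `F0P6aKottwitzAtOmegaOfComplexPoints` (Kottwitz at the `Ω`-points of door (E)'s tuple) THROUGH an identification of tuples — an isomorphism of
PEL tuples along `𝟙 (Spec Ω)` ([MumfordFogartyKirwan1994] Def. 7.2–7.3, the cell's `tupleIsoAt` ∕ `TupleIsoAt₂` letters) or a pull-back relation
(`IsBaseChangeVia`, the classifying-map provenance `hTj` ∕ `hPε` of «M-47»).  This file is the TRANSPORT: the characteristic polynomial of `ι(b)`
on the cotangent space at the origin of a geometric fibre does not change under either.  HC_CM is proved only modulo the printed citations until
rung 0 closes; nothing here is about HC.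

THE MATHEMATICS ([Kottwitz1992] §5 p. 390: the determinant ∕ trace condition on `Lie(A)` is a condition on the ISOMORPHISM CLASS of `(A, ι)` and is
«compatible with base change»; [LangeBirkenhake1992] §1.1.2 Lemma 1.1.11: an isomorphism `φ : A → B` with `u φ = φ u′` conjugates the analytic
representations, `ρ_a(u) = ρ_a(φ)⁻¹ ρ_a(u′) ρ_a(φ)`; [GortzWedhorn2020] (4.7), Prop. 4.16: the fibre of a pull-back `A ×_S S′` at `s′` IS the fibre of
`A` at `s′ ≫ p`).  Hence:
* §1 `charpoly_cotangentMap_eq_of_iso` — over a field: `e : A ≅ B`, `u ≫ e = e ≫ u′` ⇒ `char(u^*) = char(u′^*)` (★ `charpoly_cotangentMap_eq_of_comp_eq_nsmul`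
  at `n = 1`);
* §2 `charpoly_cotangentMap_fibreHom_eq_of_iso` — an isomorphism `e : A₁ ≅ A₂` of `S`-group schemes intertwining `u₁`, `u₂` gives equal
  characteristic polynomials at EVERY geometric fibre (★ `fibreIsoOfIso`, ★ `fibreHom_comp`);
* §3 `IsBaseChangeVia.charpoly_cotangentMap_fibreHom_eq` — a pull-back relation `π : A′ → A` over `p : S′ → S` (`A′.IsBaseChangeVia A p π`)
  intertwining `u′`, `u` gives `char(u′^* | A′_{s′}) = char(u^* | A_{s′ ≫ p})` (★ `IsBaseChangeVia.exists_fibreIso` + its naturality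
  ★ `fibreHom_comp_eq_of_left_comp_eq`); ring-action form `IsBaseChangeVia.charpoly_cotangentMap_fibreHom_i_eq`;
* §4 `charpoly_cotangentMap_fibreHom_eq_of_isBaseChangeVia_id` — the `X`-clause of an isomorphism of tuples ALONG `𝟙 T` (`G : A₁ → A₂` a base change
  of group schemes along `𝟙 T`, hence an isomorphism of `T`-group schemes, ★ `isMonHom_of_isBaseChangeVia_id`) + the action clause
  `ι₁(a) ≫ G = G ≫ ι₂(a)` give equal characteristic polynomials at every geometric point of `T`; ring-action form `…_fibreHom_i_eq_…`;
* §5 `charpoly_cotangentMap_fibreHom_i_eq_of_tupleRel_id` — the same read on the full six-clause relation (level ∕ `X`, `X̂`, Poincaré, `λ`, action: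
  the cell's `tupleIsoAt` ∕ `TupleIsoAt₂` UNFOLDED), and `kottwitz_iff_of_tupleRel_id` — a Kottwitz ROOT FORM `char = ∏_τ (X − τ(b))^{m τ}` holds for
  one tuple iff for the other.

* §6 (ED. 2) `charpoly_cotangentMap_fibreHom_eq_of_iso_baseChange` ∕ `…_of_isBaseChangeVia_id_baseChange` ∕ `…_i_eq_of_tupleIsoVia` ∕
  `kottwitz_iff_of_tupleIsoVia` — AT THE POINTS THEMSELVES: the relation lives between the base changes `𝒜₁ ×_Y t₁`, `𝒜₂ ×_Y t₂` over `Spec Ω` (the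
  cell's `TupleIsoVia t …` ∕ `TupleIsoAt₂` ∕ `gen_iso` shape at `t₁ = t₂`, Defs `tupleIsoAt t₁ t₂` at `𝒜₁ = 𝒜₂`, both VERBATIM) and the conclusion is in
  the `fibre tᵢ` ∕ `fibreHom · tᵢ` currency of `kottwitz` ∕ `KottwitzΩ`.

## References
* [Kottwitz1992] R. E. Kottwitz, *Points on some Shimura varieties over finite fields*, J. Amer. Math. Soc. 5 (1992), §5 pp. 389–391.
* [LangeBirkenhake1992] H. Lange, Ch. Birkenhake, *Complex Abelian Varieties* (1992), §1.1.2 Lemma 1.1.11, Prop. 1.1.15.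
* [MumfordFogartyKirwan1994] D. Mumford, J. Fogarty, F. Kirwan, *Geometric Invariant Theory*, 3rd ed. (1994), Ch. 7 §2 Def. 7.2 (p. 129), Def. 7.3 (p. 130).
* [GortzWedhorn2020] U. Görtz, T. Wedhorn, *Algebraic Geometry I*, 2nd ed. (2020), Section (4.7) (pp. 107–108), Prop. 4.16 (p. 101).
* [RapoportSmithlingZhang2020Diagonal] M. Rapoport, B. Smithling, W. Zhang, *Arithmetic diagonal cycles on unitary Shimura varieties*,
  Compos. Math. 156 (2020), §4.1 (p. 17) (the Kottwitz condition in the moduli problem).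
-/

set_option autoImplicit false

noncomputable section

-- Mathlib's `Over`/pull-back API is stated across semireducible wrappers (as in the ★ `AbelianSchemes/*` files).
set_option backward.isDefEq.respectTransparency false

universe u

open CategoryTheory CategoryTheory.Limits AlgebraicGeometry
open scoped MonObj

/-! ### §1 Over a field: conjugation by an isomorphism -/

namespace Literature.AlgebraicGeometry.Motives.AbelianVariety

variable {K : Type u} [Field K] {A B : AbelianVariety K}

/-- **`char(u^* | T_e^* A) = char(u′^* | T_e^* B)` for endomorphisms conjugate under an ISOMORPHISM `e : A ≅ B`** (`u ≫ e = e ≫ u′`): the case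
`n = 1` of ★ `charpoly_cotangentMap_eq_of_comp_eq_nsmul` (`e e⁻¹ = 1 = e⁻¹ e`). [cite: LangeBirkenhake1992, §1.1.2 Lemma 1.1.11 and Prop. 1.1.15 (held chunks p0021–p0022)] -/
theorem charpoly_cotangentMap_eq_of_iso (e : A ≅ B) {u : A ⟶ A} {u' : B ⟶ B} (hu : u ≫ e.hom = e.hom ≫ u') :
    (cotangentMap A u).charpoly = (cotangentMap B u').charpoly :=
  charpoly_cotangentMap_eq_of_comp_eq_nsmul (φ := e.hom) (ψ := e.inv) (n := 1) (by rw [Iso.hom_inv_id, one_nsmul])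
    (by rw [Iso.inv_hom_id, one_nsmul]) (by rw [Nat.cast_one]; exact one_ne_zero) hu

end Literature.AlgebraicGeometry.Motives.AbelianVariety

namespace Literature.AlgebraicGeometry.AbelianSchemes

namespace AbelianSchemeOver

open Literature.AlgebraicGeometry.Motives
open Literature.AlgebraicGeometry.Motives.AbelianVariety (cotangentMap charpoly_cotangentMap_eq_of_iso)

/-! ### §2 Fibres of an isomorphism of `S`-group schemes -/

section OfIso

variable {S : Scheme.{u}} {A₁ A₂ : AbelianSchemeOver S} {Ω : Type u} [Field Ω]

/-- `fibreHom` only depends on the homomorphism (rewriting under the instance argument). [cite: GortzWedhorn2020, Section (4.7) (pp. 107–108)] -/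
private theorem fibreHom_eq_of_hom_eq {A B : AbelianSchemeOver S} {f g : A.X ⟶ B.X} [IsMonHom f] [IsMonHom g] (h : f = g)
    (s : Spec (.of Ω) ⟶ S) : fibreHom f s = fibreHom g s := by
  subst h
  rfl

/-- **An isomorphism of `S`-group schemes intertwining two endomorphisms gives EQUAL characteristic polynomials on the cotangent spaces of
every geometric fibre**: `u₁ ≫ e = e ≫ u₂` ⇒ `char((u₁)_s^*) = char((u₂)_s^*)` for every `s : Spec Ω → S` (the fibre isomorphism ★ `fibreIsoOfIso e s`
intertwines `(u₁)_s` and `(u₂)_s` by functoriality ★ `fibreHom_comp`; then §1). [cite: GortzWedhorn2020, Section (4.7) (pp. 107–108)]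
[cite: LangeBirkenhake1992, §1.1.2 Lemma 1.1.11 and Prop. 1.1.15 (held chunks p0021–p0022)] -/
theorem charpoly_cotangentMap_fibreHom_eq_of_iso (e : A₁.X ≅ A₂.X) [IsMonHom e.hom] (u₁ : A₁.X ⟶ A₁.X) (u₂ : A₂.X ⟶ A₂.X)
    [IsMonHom u₁] [IsMonHom u₂] (hu : u₁ ≫ e.hom = e.hom ≫ u₂) (s : Spec (.of Ω) ⟶ S) :
    (cotangentMap (A₁.fibre s).toAbelianVariety (fibreHom u₁ s)).charpoly =
      (cotangentMap (A₂.fibre s).toAbelianVariety (fibreHom u₂ s)).charpoly := by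
  refine charpoly_cotangentMap_eq_of_iso (fibreIsoOfIso e s) ?_
  rw [fibreIsoOfIso_hom_eq_fibreHom, ← fibreHom_comp, ← fibreHom_comp]
  exact fibreHom_eq_of_hom_eq hu s

/-- Ring-action form of §2: an isomorphism of `S`-group schemes that is `𝒪`-LINEAR (`ι₁(a) ≫ e = e ≫ ι₂(a)`) gives, for every `b` and every geometric
point `s`, `char(ι₁(b)_s^*) = char(ι₂(b)_s^*)`. [cite: Kottwitz1992, §5 p. 390] [cite: GortzWedhorn2020, Section (4.7) (pp. 107–108)] -/
theorem charpoly_cotangentMap_fibreHom_i_eq_of_iso {O : Type*} [CommRing O] (ρ₁ : RingAction O A₁) (ρ₂ : RingAction O A₂)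
    (e : A₁.X ≅ A₂.X) [IsMonHom e.hom] (he : ∀ a, ρ₁.i a ≫ e.hom = e.hom ≫ ρ₂.i a) (s : Spec (.of Ω) ⟶ S) (b : O) :
    haveI := ρ₁.isMonHom b
    haveI := ρ₂.isMonHom b
    (cotangentMap (A₁.fibre s).toAbelianVariety (fibreHom (ρ₁.i b) s)).charpoly =
      (cotangentMap (A₂.fibre s).toAbelianVariety (fibreHom (ρ₂.i b) s)).charpoly :=
  haveI := ρ₁.isMonHom b
  haveI := ρ₂.isMonHom b
  charpoly_cotangentMap_fibreHom_eq_of_iso e _ _ (he b) s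

end OfIso

/-! ### §3 Along a pull-back relation `π : A′ → A` over `p : S′ → S` -/

section OfIsBaseChangeVia

variable {S S' : Scheme.{u}} {p : S' ⟶ S} {A' : AbelianSchemeOver S'} {A : AbelianSchemeOver S} {π : A'.X.left ⟶ A.X.left}
  {Ω : Type u} [Field Ω]

/-- **The Kottwitz characteristic polynomial is COMPATIBLE WITH BASE CHANGE**: if `π : A′ → A` exhibits `A′` as the base change of `A` along
`p : S′ → S` as group schemes (`A′.IsBaseChangeVia A p π`) and intertwines the endomorphisms `u′` of `A′` and `u` of `A` (`u′ ≫ π = π ≫ u` on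
underlying schemes), then at every geometric point `s′` of `S′`, **`char(u′^* | T_e^* A′_{s′}) = char(u^* | T_e^* A_{s′ ≫ p})`** — the fibre
isomorphism `A′_{s′} ≅ A_{s′ ≫ p}` over `π` (★ `IsBaseChangeVia.exists_fibreIso`) is natural (★ `fibreHom_comp_eq_of_left_comp_eq`), then §1.
[cite: Kottwitz1992, §5 p. 390] [cite: GortzWedhorn2020, Section (4.7) (pp. 107–108) and Prop. 4.16 (p. 101)]
[cite: MumfordFogartyKirwan1994, Ch. 7 §2 Definition 7.2 (p. 129)] -/
theorem IsBaseChangeVia.charpoly_cotangentMap_fibreHom_eq (h : A'.IsBaseChangeVia A p π) (u' : A'.X ⟶ A'.X) (u : A.X ⟶ A.X)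
    [IsMonHom u'] [IsMonHom u] (hu : u'.left ≫ π = π ≫ u.left) (s' : Spec (.of Ω) ⟶ S') :
    (cotangentMap (A'.fibre s').toAbelianVariety (fibreHom u' s')).charpoly =
      (cotangentMap (A.fibre (s' ≫ p)).toAbelianVariety (fibreHom u (s' ≫ p))).charpoly := by
  obtain ⟨e, he⟩ := h.exists_fibreIso s'
  exact charpoly_cotangentMap_eq_of_iso e (fibreHom_comp_eq_of_left_comp_eq s' e he e he u' u hu)

/-- Ring-action form of §3 (the provenance shape of «M-47»: the spread ∕ door-(E) tuple IS the pull-back of a universal tuple along a classifying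
map `p`, with `𝒪`-linear comparison `π`): for every `b` and every geometric point `s′`, `char(ι′(b)^* | A′_{s′}) = char(ι(b)^* | A_{s′ ≫ p})` — so a
Kottwitz condition for `(A, ι)` at the points `s′ ≫ p` IS a Kottwitz condition for `(A′, ι′)` at the points `s′`. [cite: Kottwitz1992, §5 p. 390]
[cite: RapoportSmithlingZhang2020Diagonal, §4.1 p. 17] [cite: GortzWedhorn2020, Section (4.7) (pp. 107–108) and Prop. 4.16 (p. 101)] -/
theorem IsBaseChangeVia.charpoly_cotangentMap_fibreHom_i_eq (h : A'.IsBaseChangeVia A p π) {O : Type*} [CommRing O]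
    (ρ' : RingAction O A') (ρ : RingAction O A) (hρ : ∀ a, (ρ'.i a).left ≫ π = π ≫ (ρ.i a).left) (s' : Spec (.of Ω) ⟶ S') (b : O) :
    haveI := ρ'.isMonHom b
    haveI := ρ.isMonHom b
    (cotangentMap (A'.fibre s').toAbelianVariety (fibreHom (ρ'.i b) s')).charpoly =
      (cotangentMap (A.fibre (s' ≫ p)).toAbelianVariety (fibreHom (ρ.i b) (s' ≫ p))).charpoly :=
  haveI := ρ'.isMonHom b
  haveI := ρ.isMonHom b
  h.charpoly_cotangentMap_fibreHom_eq _ _ (hρ b) s'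

end OfIsBaseChangeVia

/-! ### §4 Along an isomorphism of tuples over `𝟙 T` (the `X`-clause and the action clause of MFK Def. 7.2–7.3) -/

section OfId

variable {T : Scheme.{u}} {A₁ A₂ : AbelianSchemeOver T} {G : A₁.X.left ⟶ A₂.X.left} {Ω : Type u} [Field Ω]

/-- **The `X`-clause of an isomorphism of tuples along `𝟙 T` plus the action clause transport the Kottwitz characteristic polynomial**: if
`G : A₁ → A₂` is a base change of group schemes along `𝟙 T` (so an isomorphism of `T`-group schemes — Mathlib `IsPullback.isIso_fst_of_isIso`, ★
`isMonHom_of_isBaseChangeVia_id`) with `u₁ ≫ G = G ≫ u₂`, then `char((u₁)_s^*) = char((u₂)_s^*)` at every geometric point `s` of `T` (§2).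
[cite: MumfordFogartyKirwan1994, Ch. 7 §2 Definition 7.2 (p. 129) and Definition 7.3 (p. 130)] [cite: Kottwitz1992, §5 p. 390] -/
theorem charpoly_cotangentMap_fibreHom_eq_of_isBaseChangeVia_id (h : A₁.IsBaseChangeVia A₂ (𝟙 T) G) (u₁ : A₁.X ⟶ A₁.X)
    (u₂ : A₂.X ⟶ A₂.X) [IsMonHom u₁] [IsMonHom u₂] (hu : u₁.left ≫ G = G ≫ u₂.left) (s : Spec (.of Ω) ⟶ T) :
    (cotangentMap (A₁.fibre s).toAbelianVariety (fibreHom u₁ s)).charpoly =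
      (cotangentMap (A₂.fibre s).toAbelianVariety (fibreHom u₂ s)).charpoly := by
  obtain ⟨w, hpb, -, -⟩ := id h
  haveI : IsIso G := hpb.isIso_fst_of_isIso
  let e : A₁.X ≅ A₂.X := Over.isoMk (asIso G) (by rw [asIso_hom, w, Category.comp_id])
  haveI : IsMonHom e.hom := isMonHom_of_isBaseChangeVia_id e.hom h
  refine charpoly_cotangentMap_fibreHom_eq_of_iso e u₁ u₂ ?_ s
  ext
  rw [Over.comp_left, Over.comp_left]
  exact hu

/-- Ring-action form of §4: `G` a base change of group schemes along `𝟙 T` with `ι₁(a) ≫ G = G ≫ ι₂(a)` for all `a` ⇒ for every `b` and every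
geometric point `s`, `char(ι₁(b)_s^*) = char(ι₂(b)_s^*)`. [cite: Kottwitz1992, §5 p. 390] [cite: MumfordFogartyKirwan1994, Ch. 7 §2 Definition 7.2 (p. 129)] -/
theorem charpoly_cotangentMap_fibreHom_i_eq_of_isBaseChangeVia_id (h : A₁.IsBaseChangeVia A₂ (𝟙 T) G) {O : Type*} [CommRing O]
    (ρ₁ : RingAction O A₁) (ρ₂ : RingAction O A₂) (hρ : ∀ a, (ρ₁.i a).left ≫ G = G ≫ (ρ₂.i a).left) (s : Spec (.of Ω) ⟶ T) (b : O) :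
    haveI := ρ₁.isMonHom b
    haveI := ρ₂.isMonHom b
    (cotangentMap (A₁.fibre s).toAbelianVariety (fibreHom (ρ₁.i b) s)).charpoly =
      (cotangentMap (A₂.fibre s).toAbelianVariety (fibreHom (ρ₂.i b) s)).charpoly :=
  haveI := ρ₁.isMonHom b
  haveI := ρ₂.isMonHom b
  charpoly_cotangentMap_fibreHom_eq_of_isBaseChangeVia_id h _ _ (hρ b) s

end OfId

/-! ### §5 Read on the six-clause relation (the cell's `tupleIsoAt` ∕ `TupleIsoAt₂`, UNFOLDED) and on Kottwitz root forms -/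

section OfTupleRel

variable {T : Scheme.{u}} {A₁ A₂ : AbelianSchemeOver T} {D₁ : A₁.DualPair} {D₂ : A₂.DualPair}
  {lam₁ : A₁.X ⟶ D₁.hat.X} {lam₂ : A₂.X ⟶ D₂.hat.X} {g n : ℕ} {φ₁ : A₁.LevelStructure g n} {φ₂ : A₂.LevelStructure g n}
  {O : Type*} [CommRing O] (ρ₁ : RingAction O A₁) (ρ₂ : RingAction O A₂)
  {G : A₁.X.left ⟶ A₂.X.left} {Ĝ : D₁.hat.X.left ⟶ D₂.hat.X.left} {Ω : Type u} [Field Ω]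

/-- **AN ISOMORPHISM OF PEL TUPLES ALONG `𝟙 T` PRESERVES THE KOTTWITZ CHARACTERISTIC POLYNOMIALS** — read on the full six-clause relation of
[MumfordFogartyKirwan1994] Def. 7.2–7.3 with `𝒪`-action (level ∕ `X`, `X̂`, Poincaré, `λ`, `ι₁(a) ≫ G = G ≫ ι₂(a)`; = the cell letters `tupleIsoAt`
∕ `TupleIsoAt₂` UNFOLDED, so that they feed this by `obtain`): only the `X`-clause (inside the level clause) and the action clause are used (§4).
[cite: MumfordFogartyKirwan1994, Ch. 7 §2 Definition 7.2 (p. 129) and Definition 7.3 (p. 130)] [cite: Kottwitz1992, §5 p. 390]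
[cite: RapoportSmithlingZhang2020Diagonal, §4.1 p. 17] -/
theorem charpoly_cotangentMap_fibreHom_i_eq_of_tupleRel_id
    (h : φ₁.IsBaseChangeVia φ₂ (𝟙 T) G ∧ D₁.hat.IsBaseChangeVia D₂.hat (𝟙 T) Ĝ ∧
      (∃ (wG : A₁.X.hom ≫ 𝟙 T = G ≫ A₂.X.hom) (wĜ : D₁.hat.X.hom ≫ 𝟙 T = Ĝ ≫ D₂.hat.X.hom),
        Nonempty ((Scheme.Modules.pullback
          (pullback.map A₁.X.hom D₁.hat.X.hom A₂.X.hom D₂.hat.X.hom G Ĝ (𝟙 T) wG wĜ)).obj D₂.P ≅ D₁.P)) ∧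
      lam₁.left ≫ Ĝ = G ≫ lam₂.left ∧ ∀ a : O, (ρ₁.i a).left ≫ G = G ≫ (ρ₂.i a).left)
    (s : Spec (.of Ω) ⟶ T) (b : O) :
    haveI := ρ₁.isMonHom b
    haveI := ρ₂.isMonHom b
    (cotangentMap (A₁.fibre s).toAbelianVariety (fibreHom (ρ₁.i b) s)).charpoly =
      (cotangentMap (A₂.fibre s).toAbelianVariety (fibreHom (ρ₂.i b) s)).charpoly :=
  charpoly_cotangentMap_fibreHom_i_eq_of_isBaseChangeVia_id h.1.1 ρ₁ ρ₂ h.2.2.2.2 s b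

/-- **A KOTTWITZ ROOT FORM HOLDS FOR ONE TUPLE IFF FOR THE OTHER** along an isomorphism of PEL tuples over `𝟙 T`: with any exponent recipe
`rhs b` (e.g. `∏_τ (X − C (τ b))^{m τ}`), `char(ι₁(b)_s^*) = rhs b` for all `b` iff `char(ι₂(b)_s^*) = rhs b` for all `b`.
[cite: Kottwitz1992, §5 p. 390] [cite: RapoportSmithlingZhang2020Diagonal, §4.1 p. 17]
[cite: MumfordFogartyKirwan1994, Ch. 7 §2 Definition 7.2 (p. 129) and Definition 7.3 (p. 130)] -/
theorem kottwitz_iff_of_tupleRel_id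
    (h : φ₁.IsBaseChangeVia φ₂ (𝟙 T) G ∧ D₁.hat.IsBaseChangeVia D₂.hat (𝟙 T) Ĝ ∧
      (∃ (wG : A₁.X.hom ≫ 𝟙 T = G ≫ A₂.X.hom) (wĜ : D₁.hat.X.hom ≫ 𝟙 T = Ĝ ≫ D₂.hat.X.hom),
        Nonempty ((Scheme.Modules.pullback
          (pullback.map A₁.X.hom D₁.hat.X.hom A₂.X.hom D₂.hat.X.hom G Ĝ (𝟙 T) wG wĜ)).obj D₂.P ≅ D₁.P)) ∧
      lam₁.left ≫ Ĝ = G ≫ lam₂.left ∧ ∀ a : O, (ρ₁.i a).left ≫ G = G ≫ (ρ₂.i a).left)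
    (s : Spec (.of Ω) ⟶ T) (rhs : O → Polynomial Ω) :
    (∀ b : O, haveI := ρ₁.isMonHom b
      (cotangentMap (A₁.fibre s).toAbelianVariety (fibreHom (ρ₁.i b) s)).charpoly = rhs b) ↔
    (∀ b : O, haveI := ρ₂.isMonHom b
      (cotangentMap (A₂.fibre s).toAbelianVariety (fibreHom (ρ₂.i b) s)).charpoly = rhs b) := by
  refine forall_congr' fun b => ?_
  rw [charpoly_cotangentMap_fibreHom_i_eq_of_tupleRel_id ρ₁ ρ₂ h s b]

end OfTupleRel

/-! ### §5′ The same along a pull-back relation (provenance form): a Kottwitz root form at `s′ ≫ p` for `(A, ι)` iff at `s′` for `(A′, ι′)` -/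

section KottwitzOfIsBaseChangeVia

variable {S S' : Scheme.{u}} {p : S' ⟶ S} {A' : AbelianSchemeOver S'} {A : AbelianSchemeOver S} {π : A'.X.left ⟶ A.X.left}
  {Ω : Type u} [Field Ω]

/-- **KOTTWITZ ROOT FORMS ARE COMPATIBLE WITH BASE CHANGE** (provenance form): along an `𝒪`-linear pull-back relation `π : A′ → A` over `p`, for every
geometric point `s′` of `S′` and any exponent recipe `rhs`, `char(ι′(b)^* | A′_{s′}) = rhs b` for all `b` iff `char(ι(b)^* | A_{s′ ≫ p}) = rhs b` for all
`b` (§3). [cite: Kottwitz1992, §5 p. 390] [cite: RapoportSmithlingZhang2020Diagonal, §4.1 p. 17]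
[cite: GortzWedhorn2020, Section (4.7) (pp. 107–108) and Prop. 4.16 (p. 101)] -/
theorem IsBaseChangeVia.kottwitz_iff (h : A'.IsBaseChangeVia A p π) {O : Type*} [CommRing O]
    (ρ' : RingAction O A') (ρ : RingAction O A) (hρ : ∀ a, (ρ'.i a).left ≫ π = π ≫ (ρ.i a).left) (s' : Spec (.of Ω) ⟶ S')
    (rhs : O → Polynomial Ω) :
    (∀ b : O, haveI := ρ'.isMonHom b
      (cotangentMap (A'.fibre s').toAbelianVariety (fibreHom (ρ'.i b) s')).charpoly = rhs b) ↔
    (∀ b : O, haveI := ρ.isMonHom b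
      (cotangentMap (A.fibre (s' ≫ p)).toAbelianVariety (fibreHom (ρ.i b) (s' ≫ p))).charpoly = rhs b) := by
  refine forall_congr' fun b => ?_
  rw [h.charpoly_cotangentMap_fibreHom_i_eq ρ' ρ hρ s' b]

end KottwitzOfIsBaseChangeVia

/-! ### §6 (ED. 2) AT THE POINTS THEMSELVES — a relation between base changes `𝒜₁ ×_Y t₁`, `𝒜₂ ×_Y t₂` over `Spec Ω`
(the cell's `TupleIsoVia t …` ∕ `TupleIsoAt₂ t …` (two tuples, one point) and `tupleIsoAt t₁ t₂ …` (one tuple, two points) shapes), conclusion in the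
`fibre tᵢ` ∕ `fibreHom · tᵢ` currency of the E-witness's `kottwitz` and (★ `charpoly_cotangentMap_fibreHom_eq_baseChange`, `rfl`) of the spine's `KottwitzΩ` -/

section AtPoints

variable {Y : Scheme.{u}} {𝒜₁ 𝒜₂ : AbelianSchemeOver Y} {Ω : Type u} [Field Ω] (t₁ t₂ : Spec (.of Ω) ⟶ Y)

/-- **An isomorphism `e : 𝒜₁ ×_Y t₁ ≅ 𝒜₂ ×_Y t₂` of group schemes over `Spec Ω` intertwining `(u₁)_{t₁}`, `(u₂)_{t₂}` gives
`char((u₁)_{t₁}^*) = char((u₂)_{t₂}^*)`** on the cotangent spaces of the fibres (the fibre IS the base change, ★ `fibre t := (baseChange t).toAffine`; `e` read as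
an isomorphism of abelian varieties through `InducedCategory.isoMk (Grp.mkIso' e)`, then §1).
[cite: LangeBirkenhake1992, §1.1.2 Lemma 1.1.11 and Prop. 1.1.15 (held chunks p0021–p0022)] [cite: GortzWedhorn2020, Section (4.7) (pp. 107–108)] -/
theorem charpoly_cotangentMap_fibreHom_eq_of_iso_baseChange (e : (𝒜₁.baseChange t₁).X ≅ (𝒜₂.baseChange t₂).X) [IsMonHom e.hom]
    (u₁ : 𝒜₁.X ⟶ 𝒜₁.X) (u₂ : 𝒜₂.X ⟶ 𝒜₂.X) [IsMonHom u₁] [IsMonHom u₂]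
    (hu : (baseChangeHom u₁ t₁).left ≫ e.hom.left = e.hom.left ≫ (baseChangeHom u₂ t₂).left) :
    (cotangentMap (𝒜₁.fibre t₁).toAbelianVariety (fibreHom u₁ t₁)).charpoly =
      (cotangentMap (𝒜₂.fibre t₂).toAbelianVariety (fibreHom u₂ t₂)).charpoly := by
  refine charpoly_cotangentMap_eq_of_iso
    (InducedCategory.isoMk (X := (𝒜₁.fibre t₁).toAbelianVariety) (Y := (𝒜₂.fibre t₂).toAbelianVariety) (Grp.mkIso' e)) ?_
  apply AbelianVariety.hom_ext
  apply Over.OverMorphism.ext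
  exact hu

/-- **The `X`-clause ALONG `𝟙 (Spec Ω)` between the base changes + the action clause give `char((u₁)_{t₁}^*) = char((u₂)_{t₂}^*)`**:
`G : 𝒜₁ ×_Y t₁ → 𝒜₂ ×_Y t₂` a base change of group schemes along `𝟙` (hence an isomorphism of `Ω`-group schemes, ★ `isMonHom_of_isBaseChangeVia_id`) with
`(u₁)_{t₁} ≫ G = G ≫ (u₂)_{t₂}` — exactly the `X`-clause and (for `uᵢ = ιᵢ(a)`) the action clause of the cell letters `TupleIsoVia` ∕ `tupleIsoAt`.
[cite: MumfordFogartyKirwan1994, Ch. 7 §2 Definition 7.2 (p. 129) and Definition 7.3 (p. 130)] [cite: Kottwitz1992, §5 p. 390] -/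
theorem charpoly_cotangentMap_fibreHom_eq_of_isBaseChangeVia_id_baseChange {G : (𝒜₁.baseChange t₁).X.left ⟶ (𝒜₂.baseChange t₂).X.left}
    (h : (𝒜₁.baseChange t₁).IsBaseChangeVia (𝒜₂.baseChange t₂) (𝟙 _) G) (u₁ : 𝒜₁.X ⟶ 𝒜₁.X) (u₂ : 𝒜₂.X ⟶ 𝒜₂.X)
    [IsMonHom u₁] [IsMonHom u₂] (hu : (baseChangeHom u₁ t₁).left ≫ G = G ≫ (baseChangeHom u₂ t₂).left) :
    (cotangentMap (𝒜₁.fibre t₁).toAbelianVariety (fibreHom u₁ t₁)).charpoly =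
      (cotangentMap (𝒜₂.fibre t₂).toAbelianVariety (fibreHom u₂ t₂)).charpoly := by
  obtain ⟨w, hpb, -, -⟩ := id h
  haveI : IsIso G := hpb.isIso_fst_of_isIso
  let e : (𝒜₁.baseChange t₁).X ≅ (𝒜₂.baseChange t₂).X := Over.isoMk (asIso G) (by rw [asIso_hom, w, Category.comp_id])
  haveI : IsMonHom e.hom := isMonHom_of_isBaseChangeVia_id e.hom h
  exact charpoly_cotangentMap_fibreHom_eq_of_iso_baseChange t₁ t₂ e u₁ u₂ hu

variable {O : Type*} [CommRing O] (ρ₁ : RingAction O 𝒜₁) (ρ₂ : RingAction O 𝒜₂)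
  {D₁ : 𝒜₁.DualPair} {D₂ : 𝒜₂.DualPair} (pol₁ : 𝒜₁.Polarization D₁) (pol₂ : 𝒜₂.Polarization D₂)
  {g N : ℕ} (lvl₁ : 𝒜₁.LevelStructure g N) (lvl₂ : 𝒜₂.LevelStructure g N)
  {G : (𝒜₁.baseChange t₁).X.left ⟶ (𝒜₂.baseChange t₂).X.left} {Ĝ : (D₁.baseChange t₁).hat.X.left ⟶ (D₂.baseChange t₂).hat.X.left}

/-- **AN ISOMORPHISM OF PEL TUPLES READ AT `t₁`, `t₂` PRESERVES THE KOTTWITZ CHARACTERISTIC POLYNOMIALS** — the six clauses along `𝟙 (Spec Ω)` between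
`𝒜₁ ×_Y t₁` and `𝒜₂ ×_Y t₂` with their actions, duals, Poincaré bundles, polarisations and levels: at `t₁ = t₂ = t` this is VERBATIM the body of the cell's
`TupleIsoVia t 𝒜₁ ρ₁ D₁ pol₁ lvl₁ 𝒜₂ ρ₂ D₂ pol₂ lvl₂ G Ĝ` (P-line provenance `gen_iso`), at `𝒜₁ = 𝒜₂` VERBATIM the body of Defs `tupleIsoAt t₁ t₂ 𝒜 ρ D pol lvl`.
For every `b`, `char(ι₁(b)_{t₁}^* | (𝒜₁)_{t₁}) = char(ι₂(b)_{t₂}^* | (𝒜₂)_{t₂})` in the `fibre`∕`fibreHom` currency (= the spine's `baseChange`∕`.i` currency by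
★ `charpoly_cotangentMap_fibreHom_eq_baseChange`, `rfl`). [cite: Kottwitz1992, §5 p. 390] [cite: RapoportSmithlingZhang2020Diagonal, §4.1 p. 17]
[cite: MumfordFogartyKirwan1994, Ch. 7 §2 Definition 7.2 (p. 129) and Definition 7.3 (p. 130)] -/
theorem charpoly_cotangentMap_fibreHom_i_eq_of_tupleIsoVia
    (h : (lvl₁.baseChange t₁).IsBaseChangeVia (lvl₂.baseChange t₂) (𝟙 _) G ∧
      (D₁.baseChange t₁).hat.IsBaseChangeVia (D₂.baseChange t₂).hat (𝟙 _) Ĝ ∧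
      (∃ (wG : (𝒜₁.baseChange t₁).X.hom ≫ 𝟙 _ = G ≫ (𝒜₂.baseChange t₂).X.hom)
          (wĜ : (D₁.baseChange t₁).hat.X.hom ≫ 𝟙 _ = Ĝ ≫ (D₂.baseChange t₂).hat.X.hom),
        Nonempty ((Scheme.Modules.pullback
          (pullback.map (𝒜₁.baseChange t₁).X.hom (D₁.baseChange t₁).hat.X.hom (𝒜₂.baseChange t₂).X.hom (D₂.baseChange t₂).hat.X.hom
            G Ĝ (𝟙 _) wG wĜ)).obj (D₂.baseChange t₂).P ≅ (D₁.baseChange t₁).P)) ∧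
      (pol₁.baseChange t₁).lam.left ≫ Ĝ = G ≫ (pol₂.baseChange t₂).lam.left ∧
      ∀ a : O, (baseChangeHom (ρ₁.i a) t₁).left ≫ G = G ≫ (baseChangeHom (ρ₂.i a) t₂).left)
    (b : O) :
    haveI := ρ₁.isMonHom b
    haveI := ρ₂.isMonHom b
    (cotangentMap (𝒜₁.fibre t₁).toAbelianVariety (fibreHom (ρ₁.i b) t₁)).charpoly =
      (cotangentMap (𝒜₂.fibre t₂).toAbelianVariety (fibreHom (ρ₂.i b) t₂)).charpoly :=
  haveI := ρ₁.isMonHom b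
  haveI := ρ₂.isMonHom b
  charpoly_cotangentMap_fibreHom_eq_of_isBaseChangeVia_id_baseChange t₁ t₂ h.1.1 _ _ (h.2.2.2.2 b)

/-- **KOTTWITZ ROOT FORMS TRANSPORT ALONG AN ISOMORPHISM OF PEL TUPLES READ AT `t₁`, `t₂`** (`TupleIsoVia` ∕ `tupleIsoAt` bodies VERBATIM; any exponent
recipe `rhs`): `char(ι₁(b)_{t₁}^*) = rhs b` for all `b` iff `char(ι₂(b)_{t₂}^*) = rhs b` for all `b`.  With `𝒜₁ := T.univ ×_𝓨 ι_η` (the spread tuple on the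
generic fibre), `𝒜₂ := E.P.A` (door (E)), `t₁ = t₂ := ℓ_{e′} y` and `h := T.gen_iso e′ y` this turns ★ `F0P6aKottwitzAtOmegaOfComplexPoints` (Kottwitz at the
`Ω`-points of the E-tuple) into the spine's `KottwitzΩ` row for the spread tuple — the P-line's `stub_KOTT` transport in one line.
[cite: Kottwitz1992, §5 p. 390] [cite: RapoportSmithlingZhang2020Diagonal, §4.1 p. 17]
[cite: MumfordFogartyKirwan1994, Ch. 7 §2 Definition 7.2 (p. 129) and Definition 7.3 (p. 130)] -/
theorem kottwitz_iff_of_tupleIsoVia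
    (h : (lvl₁.baseChange t₁).IsBaseChangeVia (lvl₂.baseChange t₂) (𝟙 _) G ∧
      (D₁.baseChange t₁).hat.IsBaseChangeVia (D₂.baseChange t₂).hat (𝟙 _) Ĝ ∧
      (∃ (wG : (𝒜₁.baseChange t₁).X.hom ≫ 𝟙 _ = G ≫ (𝒜₂.baseChange t₂).X.hom)
          (wĜ : (D₁.baseChange t₁).hat.X.hom ≫ 𝟙 _ = Ĝ ≫ (D₂.baseChange t₂).hat.X.hom),
        Nonempty ((Scheme.Modules.pullback
          (pullback.map (𝒜₁.baseChange t₁).X.hom (D₁.baseChange t₁).hat.X.hom (𝒜₂.baseChange t₂).X.hom (D₂.baseChange t₂).hat.X.hom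
            G Ĝ (𝟙 _) wG wĜ)).obj (D₂.baseChange t₂).P ≅ (D₁.baseChange t₁).P)) ∧
      (pol₁.baseChange t₁).lam.left ≫ Ĝ = G ≫ (pol₂.baseChange t₂).lam.left ∧
      ∀ a : O, (baseChangeHom (ρ₁.i a) t₁).left ≫ G = G ≫ (baseChangeHom (ρ₂.i a) t₂).left)
    (rhs : O → Polynomial Ω) :
    (∀ b : O, haveI := ρ₁.isMonHom b
      (cotangentMap (𝒜₁.fibre t₁).toAbelianVariety (fibreHom (ρ₁.i b) t₁)).charpoly = rhs b) ↔
    (∀ b : O, haveI := ρ₂.isMonHom b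
      (cotangentMap (𝒜₂.fibre t₂).toAbelianVariety (fibreHom (ρ₂.i b) t₂)).charpoly = rhs b) := by
  refine forall_congr' fun b => ?_
  rw [charpoly_cotangentMap_fibreHom_i_eq_of_tupleIsoVia t₁ t₂ ρ₁ ρ₂ pol₁ pol₂ lvl₁ lvl₂ h b]

end AtPoints

end AbelianSchemeOver

end Literature.AlgebraicGeometry.AbelianSchemes

end
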